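import Summits.AnomalousDissipation.AnomalousDissipation.Theorems.TaylorCertificatePair.Negative.Ceiling
import Summits.AnomalousDissipation.AnomalousDissipation.Theorems.DenseLoudDesignerForces.Negative.Scaling
import Literature.Analysis.FunctionSpaces.TorusSobolevSpaceProofs

/-!
# Negative knowledge for the crux `EnsembleCeiling` (stmt-AnomalousDissipation-14090), I:
# single-mode forces are fat, the Liouville equation is load-bearing, integrability is decoration

Crux `TaylorCertificates.EnsembleCeiling` (route `AnomalousDissipation/TaylorCertificates`, rank 4) asks
for ONE smooth divergence-free mean-zero force `f ≠ 0` on `T³` and `E`, `ν₀` such that for every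
`ν ∈ (0, ν₀)` every stationary statistical solution of `NS_ν(f)` (FMRT IV Def. 1.3,
`Torus.IsStationaryStatisticalSolution`) with integrable energy has mean energy `≤ E`.
This file (cdisprove seat `refuter-cdisprove-stmt-AnomalousDissipation-14090-0`) certifies the negative
knowledge around it; nothing here asserts a Theses statement. All objects are the tree's
(`Torus.realTrigPoly {k} (fun _ => z) = Re(e_k z)`, the mode toolkit of
`Theorems/TaylorCertificatePair/Negative/`).

* `exists_fat_stationary_of_singleMode` — for every single transversal mode `f = Re(e_k z)` (`k ≠ 0`,
  `k·z = 0`) and every `ν > 0`, the Dirac mass at the laminar state `f/(4π²|k|²ν)` is a stationary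
  statistical solution of `NS_ν(f)` with mean energy `½(4π²|k|²ν)⁻²‖z‖² = ‖f‖₂²/(16π⁴|k|⁴ν²)`
  (single modes are steady Euler shear flows: `inertial_mode`; Marchioro's laminar branch on `T³`).
* `not_ceiling_of_singleMode` — hence the conclusion of the crux FAILS for every single-mode force;
  `not_forall_forces_ensembleCeiling` — the strengthening "for EVERY admissible force" is false
  (Kolmogorov witness `cos(2πx₂)e₀`); `kolmogorov_attains_support_bound` — FMRT's a priori bound
  (1.34) `∫|u|² ≤ ‖f‖₂²/(ν²λ₁²)` is attained, so no ν-uniform bound follows from `‖f‖₂`, `ν` alone.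
* `fat_without_liouville` — for EVERY admissible `f`: probability measures with (1.29), (1.31) and
  integrable energy but without the Liouville equation (1.30) have unbounded energy as `ν → 0`
  (`δ_{Tf}`): any proof of the crux must use (1.30).
* `ensembleCeiling_integrable_redundant` — the hypothesis `Integrable (‖·‖²) μ` is removable
  (`E ↦ max E 0`; Bochner junk value).
-/

noncomputable section

set_option linter.dupNamespace false

namespace Summit.AnomalousDissipation.AnomalousDissipation.Theses.TaylorCertificates

/-- **Record of the dropped route item `EnsembleCeiling`** = stmt-AnomalousDissipation-14090 (ledger signature verbatim,
in the route file's namespace; NOT a route item): the route repair rev 13 (2026-08-16) dropped this declaration from the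
gate-written Theses file (item closed `moot`), while this append-only `Negative/` module (last theorem) and its importers
(`KolmogorovFloorEnsembleCeiling/Negative/SameForce`, …) still name it ("Unknown identifier" in builds from source since
rev 13). Re-declared here under its original fully-qualified name and definiens solely so that this negative knowledge
keeps elaborating (convention of `Theorems/TaylorCertificatesTaylorCertificatePairRefutation.lean`); added by the
cdisprove seat of stmt-AnomalousDissipation-14086 (g2), 2026-08-16. -/
def EnsembleCeiling : Prop :=
  ∃ f : UnitAddTorus (Fin 3) → EuclideanSpace ℝ (Fin 3), Literature.Analysis.FunctionSpaces.Torus.IsSmooth f ∧ Literature.Analysis.FunctionSpaces.Torus.IsDivFree f ∧ Literature.Analysis.FunctionSpaces.Torus.HasZeroMean f ∧ 0 < (∫ x, ‖f x‖ ^ 2) ∧ ∃ (E ν₀ : ℝ), 0 < ν₀ ∧ ∀ ν : ℝ, 0 < ν → ν < ν₀ → ∀ μ : MeasureTheory.Measure (Literature.Analysis.FunctionSpaces.Torus.energySpace (Fin 3)), Literature.Analysis.FluidPDE.Torus.IsStationaryStatisticalSolution ν f μ → MeasureTheory.Integrable (fun v : Literature.Analysis.FunctionSpaces.Torus.energySpace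 (Fin 3) => ‖v‖ ^ 2) μ → Literature.Analysis.FluidPDE.Torus.ensembleEnergy μ ≤ E

end Summit.AnomalousDissipation.AnomalousDissipation.Theses.TaylorCertificates

open MeasureTheory UnitAddTorus Matrix
open scoped InnerProductSpace ENNReal ComplexConjugate

namespace Summit.AnomalousDissipation.AnomalousDissipation.Theorems.EnsembleCeiling.Negative

open Literature.Analysis.FunctionSpaces Literature.Analysis.FluidPDE
open Summit.AnomalousDissipation.AnomalousDissipation.Theorems.TaylorCertificatePair.Negative

variable {k : Fin 3 → ℤ} {z : EuclideanSpace ℂ (Fin 3)}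

/-- A nonzero frequency is not its own opposite. -/
theorem ne_neg_self_of_ne_zero (hk : k ≠ 0) : k ≠ -k := by
  intro h
  apply hk
  funext i
  have hi := congrFun h i
  simp only [Pi.neg_apply] at hi
  simp only [Pi.zero_apply]
  omega

/-- The Fourier coefficient of a single real mode at its own (nonzero) frequency is half its vector. -/
theorem fc_mode_self (hk : k ≠ 0) (z : (EuclideanSpace ℂ (Fin 3))) :
    mFourierCoeff (EuclideanSpace.complexify ∘ (Torus.realTrigPoly {k} (fun _ => z))) k = (2 : ℂ)⁻¹ • z := by
  rw [fc_mode, if_pos rfl, if_neg (ne_neg_self_of_ne_zero hk), EuclideanSpace.conjVec_zero, add_zero]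

/-- Two single modes at the same nonzero frequency pair to `½ Re ⟪z', z⟫`. -/
theorem integral_inner_mode_mode (hk : k ≠ 0) (z z' : (EuclideanSpace ℂ (Fin 3))) :
    ∫ x, ⟪(Torus.realTrigPoly {k} (fun _ => z')) x, (Torus.realTrigPoly {k} (fun _ => z)) x⟫_ℝ =
      2⁻¹ * (⟪z', z⟫_ℂ).re := by
  rw [integral_inner_mode_left (isSmooth_mode k z).integrable, fc_mode_self hk, inner_smul_right]
  simp [Complex.mul_re]

/-- The Laplacian pairing of a single mode with a smooth field, in Fourier variables. -/
theorem integral_inner_mode_laplacian {G : (UnitAddTorus (Fin 3)) → (EuclideanSpace ℝ (Fin 3))} (hG : Torus.IsSmooth G)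
    (k : Fin 3 → ℤ) (z' : (EuclideanSpace ℂ (Fin 3))) :
    ∫ x, ⟪(Torus.realTrigPoly {k} (fun _ => z')) x, Torus.laplacian G x⟫_ℝ =
      -(4 * Real.pi ^ 2 * Torus.freqNormSq k) * (⟪z', mFourierCoeff (EuclideanSpace.complexify ∘ G) k⟫_ℂ).re := by
  rw [integral_inner_mode_left hG.laplacian.integrable, Torus.mFourierCoeff_complexify_laplacian hG,
    inner_neg_right, inner_smul_right, Complex.neg_re, Complex.re_ofReal_mul]
  ring

/-- **Single transversal modes are steady Euler shear flows**: their inertial term against every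
smooth field vanishes (pair formula: the `2k`-interaction carries the factor `2 k·z = 0`, the
`0`-interaction the factor `0·z`). -/
theorem inertial_mode (hz : ((fun j => ((k) j : ℂ)) ⬝ᵥ (WithLp.ofLp (z))) = 0)
    {G : (UnitAddTorus (Fin 3)) → (EuclideanSpace ℝ (Fin 3))} (hG : Torus.IsSmooth G) :
    ∫ x, ⟪Torus.fderiv G x ((Torus.realTrigPoly {k} (fun _ => z)) x), (Torus.realTrigPoly {k} (fun _ => z)) x⟫_ℝ = 0 := by
  rw [pair_formula hG k k z z, dotc_add_left, hz, add_zero, zero_mul, sub_self, dotc_zero_left, map_zero,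
    zero_mul, Complex.zero_im, mul_zero, add_zero]

/-- Gradient norm of a single mode: `‖∇ Re(e_k z)‖² ≤ 4π²|k|² ∫ ‖Re(e_k z)‖²` (in fact equality). -/
theorem toReal_eGradNormSq_mode_le (k : Fin 3 → ℤ) (z' : (EuclideanSpace ℂ (Fin 3))) :
    (Torus.eGradNormSq (Torus.realTrigPoly {k} (fun _ => z'))).toReal ≤
      4 * Real.pi ^ 2 * Torus.freqNormSq k * ∫ x, ‖(Torus.realTrigPoly {k} (fun _ => z')) x‖ ^ 2 := by
  obtain ⟨N, hN⟩ : ∃ N : ℕ, Torus.freqNormSq k ≤ (N : ℝ) ^ 2 := by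
    refine ⟨⌈Torus.freqNormSq k⌉₊ + 1, ?_⟩
    have h1 : Torus.freqNormSq k ≤ ((⌈Torus.freqNormSq k⌉₊ + 1 : ℕ) : ℝ) :=
      (Nat.le_ceil _).trans (by push_cast; linarith)
    have h2 : (1 : ℝ) ≤ ((⌈Torus.freqNormSq k⌉₊ + 1 : ℕ) : ℝ) := by push_cast; linarith [Nat.cast_nonneg (α := ℝ) ⌈Torus.freqNormSq k⌉₊]
    nlinarith
  have hband : ∀ κ, (N : ℝ) ^ 2 < Torus.freqNormSq κ →
      mFourierCoeff (EuclideanSpace.complexify ∘ (Torus.realTrigPoly {k} (fun _ => z'))) κ = 0 :=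
    fun κ hκ => fc_mode_eq_zero z' (hN.trans_lt hκ)
  rw [Torus.eGradNormSq_eq_sum_of_band_limited (continuous_mode k z') hband,
    Torus.integral_norm_sq_eq_sum_of_band_limited (continuous_mode k z') hband,
    ENNReal.toReal_ofReal (mul_nonneg (by positivity) (Finset.sum_nonneg fun κ _ =>
      mul_nonneg (Torus.freqNormSq_nonneg κ) (sq_nonneg _))), Finset.mul_sum, Finset.mul_sum]
  refine Finset.sum_le_sum fun κ _ => ?_
  have hterm : Torus.freqNormSq κ * ‖mFourierCoeff (EuclideanSpace.complexify ∘ (Torus.realTrigPoly {k} (fun _ => z'))) κ‖ ^ 2 ≤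
      Torus.freqNormSq k * ‖mFourierCoeff (EuclideanSpace.complexify ∘ (Torus.realTrigPoly {k} (fun _ => z'))) κ‖ ^ 2 := by
    by_cases h1 : κ = k
    · rw [h1]
    · by_cases h2 : κ = -k
      · rw [h2, Torus.freqNormSq_neg]
      · rw [fc_mode, if_neg h1, if_neg h2, EuclideanSpace.conjVec_zero, add_zero, smul_zero, norm_zero]
        simp
  calc 4 * Real.pi ^ 2 * (Torus.freqNormSq κ * ‖mFourierCoeff (EuclideanSpace.complexify ∘ (Torus.realTrigPoly {k} (fun _ => z'))) κ‖ ^ 2)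
      ≤ 4 * Real.pi ^ 2 * (Torus.freqNormSq k * ‖mFourierCoeff (EuclideanSpace.complexify ∘ (Torus.realTrigPoly {k} (fun _ => z'))) κ‖ ^ 2) :=
        mul_le_mul_of_nonneg_left hterm (by positivity)
    _ = 4 * Real.pi ^ 2 * Torus.freqNormSq k * ‖mFourierCoeff (EuclideanSpace.complexify ∘ (Torus.realTrigPoly {k} (fun _ => z'))) κ‖ ^ 2 := by ring

/-- **The laminar state of a single-mode force carries a stationary statistical solution of
unbounded energy.** For the force `f = Re(e_k z)` (`k ≠ 0`, `k·z = 0`) and every `ν > 0`, the Dirac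
mass at the laminar steady state `u_ν = f/(4π²|k|²ν)` is a stationary statistical solution of
`NS_ν(f)` (FMRT IV Def. 1.3) with integrable energy and mean energy
`∫ |u|² dδ = ½ (4π²|k|²ν)⁻² ‖z‖² = ‖f‖₂²/(16π⁴|k|⁴ν²)` — the 3-D face of Marchioro's laminar
branch; for `|k| = 1` it ATTAINS the FMRT support bound (1.34) `|u| ≤ |f|/(νλ₁)`. -/
theorem exists_fat_stationary_of_singleMode (hk : k ≠ 0) (hz : ((fun j => ((k) j : ℂ)) ⬝ᵥ (WithLp.ofLp (z))) = 0)
    {ν : ℝ} (hν : 0 < ν) :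
    ∃ μ : Measure (Torus.energySpace (Fin 3)),
      Torus.IsStationaryStatisticalSolution ν (Torus.realTrigPoly {k} (fun _ => z)) μ ∧
      Integrable (fun v : (Torus.energySpace (Fin 3)) => ‖v‖ ^ 2) μ ∧
      Torus.ensembleEnergy μ = 2⁻¹ * ((4 * Real.pi ^ 2 * Torus.freqNormSq k * ν)⁻¹) ^ 2 * ‖z‖ ^ 2 := by
  have hkpos : 0 < Torus.freqNormSq k := lt_of_lt_of_le one_pos (Torus.one_le_freqNormSq_of_ne_zero hk)
  set c : ℝ := (4 * Real.pi ^ 2 * Torus.freqNormSq k * ν)⁻¹ with hc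
  have hcpos : 0 < c := by positivity
  have hcν : ν * (4 * Real.pi ^ 2 * Torus.freqNormSq k) * c = 1 := by
    rw [hc]; field_simp
  set uf : (UnitAddTorus (Fin 3)) → (EuclideanSpace ℝ (Fin 3)) := Torus.realTrigPoly {k} (fun _ => ((c : ℂ) • z)) with huf
  have hzc : ((fun j => ((k) j : ℂ)) ⬝ᵥ (WithLp.ofLp (((c : ℂ) • z)))) = 0 := by
    rw [dotc_smul, hz, mul_zero]
  have hsm : Torus.IsSmooth uf := isSmooth_mode k _
  have hdf : Torus.IsDivFree uf := Torus.isDivFree_realTrigPoly_singleton hzc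
  have hzm : Torus.HasZeroMean uf := hasZeroMean_mode hk _
  have hmem : MemLp uf 2 volume := hsm.memLp 2
  obtain ⟨u, hu⟩ : ∃ u : (Torus.energySpace (Fin 3)), (((u : (Torus.energySpace (Fin 3))) : (Lp (EuclideanSpace ℝ (Fin 3)) 2 (volume : Measure (UnitAddTorus (Fin 3))))) : ((UnitAddTorus (Fin 3)) → (EuclideanSpace ℝ (Fin 3)))) =ᵐ[volume] uf :=
    ⟨⟨hmem.toLp uf, Torus.smoothSolenoidal_subset_energySpace ⟨uf, hsm, hdf, hzm, hmem.coeFn_toLp⟩⟩,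
      hmem.coeFn_toLp⟩
  have hV : ((u : (Torus.energySpace (Fin 3))) : (Lp (EuclideanSpace ℝ (Fin 3)) 2 (volume : Measure (UnitAddTorus (Fin 3))))) ∈ Torus.energySpaceV (Fin 3) :=
    Torus.smoothSolenoidal_subset_energySpaceV_holds ⟨uf, hsm, hdf, hzm, hu⟩
  -- the laminar state is a steady weak solution
  have hsteady : Torus.IsSteadyWeakSolution ν (Torus.realTrigPoly {k} (fun _ => z)) u := by
    intro w hw _ _
    rw [nsGeneratorPairing_of_ae hu, huf, inertial_mode hzc hw, add_zero,
      integral_inner_mode_left hw.integrable, integral_inner_mode_laplacian hw, inner_smul_left,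
      Complex.conj_ofReal, Complex.re_ofReal_mul]
    have : ν * (-(4 * Real.pi ^ 2 * Torus.freqNormSq k) * (c * (⟪z, mFourierCoeff (EuclideanSpace.complexify ∘ w) k⟫_ℂ).re)) =
        -(ν * (4 * Real.pi ^ 2 * Torus.freqNormSq k) * c) * (⟪z, mFourierCoeff (EuclideanSpace.complexify ∘ w) k⟫_ℂ).re := by ring
    rw [this, hcν]
    ring
  -- energy (in)equality at the laminar state
  have hpair : Torus.pairing ((u : (Torus.energySpace (Fin 3))) : (Lp (EuclideanSpace ℝ (Fin 3)) 2 (volume : Measure (UnitAddTorus (Fin 3))))) (Torus.realTrigPoly {k} (fun _ => z)) =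
      2⁻¹ * (c * ‖z‖ ^ 2) := by
    rw [pairing_of_ae hu, huf, integral_inner_mode_mode hk, inner_smul_left, Complex.conj_ofReal,
      Complex.re_ofReal_mul, inner_self_eq_norm_sq_to_K]
    norm_cast
  have henergy : ∫ x, ‖uf x‖ ^ 2 = 2⁻¹ * (c ^ 2 * ‖z‖ ^ 2) := by
    rw [huf, integral_norm_sq_mode hk, norm_smul, Complex.norm_real, Real.norm_of_nonneg hcpos.le, mul_pow]
  have hE : ν * (Torus.eGradNormSq (((u : (Torus.energySpace (Fin 3))) : (Lp (EuclideanSpace ℝ (Fin 3)) 2 (volume : Measure (UnitAddTorus (Fin 3))))) : ((UnitAddTorus (Fin 3)) → (EuclideanSpace ℝ (Fin 3))))).toReal ≤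
      Torus.pairing ((u : (Torus.energySpace (Fin 3))) : (Lp (EuclideanSpace ℝ (Fin 3)) 2 (volume : Measure (UnitAddTorus (Fin 3))))) (Torus.realTrigPoly {k} (fun _ => z)) := by
    rw [hpair, eGradNormSq_congr_ae' hu]
    have h1 := toReal_eGradNormSq_mode_le k ((c : ℂ) • z)
    rw [← huf, henergy] at h1
    calc ν * (Torus.eGradNormSq uf).toReal ≤ ν * (4 * Real.pi ^ 2 * Torus.freqNormSq k * (2⁻¹ * (c ^ 2 * ‖z‖ ^ 2))) :=
          mul_le_mul_of_nonneg_left h1 hν.le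
      _ = (ν * (4 * Real.pi ^ 2 * Torus.freqNormSq k) * c) * (2⁻¹ * (c * ‖z‖ ^ 2)) := by ring
      _ = 2⁻¹ * (c * ‖z‖ ^ 2) := by rw [hcν, one_mul]
  haveI : MeasurableSingletonClass (Torus.energySpace (Fin 3)) := OpensMeasurableSpace.toMeasurableSingletonClass
  refine ⟨Measure.dirac u, hsteady.isStationaryStatisticalSolution_dirac hV hE, Torus.integrable_dirac u _, ?_⟩
  unfold Torus.ensembleEnergy
  rw [integral_dirac, norm_sq_of_ae hu, henergy]
  ring


/-- Single transversal modes are admissible forces of the crux: smooth, divergence free, mean zero,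
with energy `∫ ‖Re(e_k z)‖² = ½‖z‖²`. -/
theorem singleMode_admissible (hk : k ≠ 0) (hz : ((fun j => ((k) j : ℂ)) ⬝ᵥ (WithLp.ofLp (z))) = 0) :
    Torus.IsSmooth (Torus.realTrigPoly {k} (fun _ => z)) ∧ Torus.IsDivFree (Torus.realTrigPoly {k} (fun _ => z)) ∧
      Torus.HasZeroMean (Torus.realTrigPoly {k} (fun _ => z)) ∧
        ∫ x, ‖(Torus.realTrigPoly {k} (fun _ => z)) x‖ ^ 2 = 2⁻¹ * ‖z‖ ^ 2 :=
  ⟨isSmooth_mode k z, Torus.isDivFree_realTrigPoly_singleton hz, hasZeroMean_mode hk z, integral_norm_sq_mode hk z⟩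

/-- **No ensemble ceiling for a single-mode force.** For `f = Re(e_k z)` (`k ≠ 0`, `k·z = 0`,
`z ≠ 0`) the conclusion of `EnsembleCeiling` fails: whatever `E` and `ν₀`, at
`ν = min(ν₀/2, 1, A/(|E|+1))`, `A = ½(4π²|k|²)⁻²‖z‖²`, the laminar Dirac mass has mean energy
`A/ν² > E`. (Marchioro's laminar branch in three dimensions: the gravest forced shell is a steady
Euler profile, so the Stokes state `(νA)⁻¹f` is an exact steady Navier–Stokes state of energy
`‖f‖²/(ν²λ²)`.) -/
theorem not_ceiling_of_singleMode (hk : k ≠ 0) (hz : ((fun j => ((k) j : ℂ)) ⬝ᵥ (WithLp.ofLp (z))) = 0) (hz0 : z ≠ 0) :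
    ¬ ∃ (E ν₀ : ℝ), 0 < ν₀ ∧ ∀ ν : ℝ, 0 < ν → ν < ν₀ → ∀ μ : Measure (Torus.energySpace (Fin 3)),
      Torus.IsStationaryStatisticalSolution ν (Torus.realTrigPoly {k} (fun _ => z)) μ →
        Integrable (fun v : (Torus.energySpace (Fin 3)) => ‖v‖ ^ 2) μ → Torus.ensembleEnergy μ ≤ E := by
  rintro ⟨E, ν₀, hν₀, h⟩
  have hkpos : 0 < Torus.freqNormSq k := lt_of_lt_of_le one_pos (Torus.one_le_freqNormSq_of_ne_zero hk)
  have hzpos : 0 < ‖z‖ := norm_pos_iff.2 hz0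
  set A : ℝ := 2⁻¹ * ((4 * Real.pi ^ 2 * Torus.freqNormSq k)⁻¹) ^ 2 * ‖z‖ ^ 2 with hA
  have hApos : 0 < A := by positivity
  have hE1 : 0 < |E| + 1 := by positivity
  set ν : ℝ := min (ν₀ / 2) (min 1 (A / (|E| + 1))) with hνdef
  have hν : 0 < ν := lt_min (half_pos hν₀) (lt_min one_pos (div_pos hApos hE1))
  have hνν₀ : ν < ν₀ := (min_le_left _ _).trans_lt (half_lt_self hν₀)
  have hν1 : ν ≤ 1 := (min_le_right _ _).trans (min_le_left _ _)
  have hνA : ν ≤ A / (|E| + 1) := (min_le_right _ _).trans (min_le_right _ _)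
  obtain ⟨μ, hμ, hint, hen⟩ := exists_fat_stationary_of_singleMode hk hz hν
  have hle := h ν hν hνν₀ μ hμ hint
  have hAν : 2⁻¹ * ((4 * Real.pi ^ 2 * Torus.freqNormSq k * ν)⁻¹) ^ 2 * ‖z‖ ^ 2 = A / ν ^ 2 := by
    rw [hA]
    field_simp
  rw [hen, hAν, div_le_iff₀ (by positivity)] at hle
  have h1 : E * ν ^ 2 ≤ |E| * ν := by
    calc E * ν ^ 2 ≤ |E| * ν ^ 2 := mul_le_mul_of_nonneg_right (le_abs_self E) (sq_nonneg ν)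
      _ ≤ |E| * ν := mul_le_mul_of_nonneg_left (by nlinarith) (abs_nonneg E)
  have h2 : |E| * ν ≤ |E| * (A / (|E| + 1)) := mul_le_mul_of_nonneg_left hνA (abs_nonneg E)
  have h3 : |E| * (A / (|E| + 1)) < A := by
    rw [mul_div_assoc', div_lt_iff₀ hE1]
    nlinarith
  linarith

/-! ### Corollaries: the `∀ f` strengthening is false; FMRT's support bound is attained -/

/-- `ê₀` is not zero. -/
theorem zhat_ne_zero : (EuclideanSpace.complexify (EuclideanSpace.single (0 : Fin 3) (1 : ℝ)) : EuclideanSpace ℂ (Fin 3)) ≠ 0 := by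
  intro h0
  have := congrArg norm h0
  rw [norm_zhat, norm_zero] at this
  exact one_ne_zero this

/-- The Kolmogorov polarisation is transversal: `e₂ · ê₀ = 0`. -/
theorem dotc_e2_zhat : ((fun j => (((![0, 1, 0] : Fin 3 → ℤ)) j : ℂ)) ⬝ᵥ (WithLp.ofLp ((EuclideanSpace.complexify (EuclideanSpace.single (0 : Fin 3) (1 : ℝ)) : EuclideanSpace ℂ (Fin 3))))) = 0 := by
  simpa using dotc_e2_smul_zhat 1

/-- **The strengthening of `EnsembleCeiling` from SOME force to EVERY admissible force is false**
(any proof must use more of `f` than smoothness, solenoidality, zero mean and `f ≠ 0`): the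
Kolmogorov force `cos(2πx₂) e₀` on `T³` is admissible and has no ensemble ceiling. -/
theorem not_forall_forces_ensembleCeiling :
    ¬ ∀ f : ((UnitAddTorus (Fin 3)) → (EuclideanSpace ℝ (Fin 3))), Torus.IsSmooth f → Torus.IsDivFree f → Torus.HasZeroMean f → 0 < (∫ x, ‖f x‖ ^ 2) →
      ∃ (E ν₀ : ℝ), 0 < ν₀ ∧ ∀ ν : ℝ, 0 < ν → ν < ν₀ → ∀ μ : Measure (Torus.energySpace (Fin 3)),
        Torus.IsStationaryStatisticalSolution ν f μ → Integrable (fun v : (Torus.energySpace (Fin 3)) => ‖v‖ ^ 2) μ →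
          Torus.ensembleEnergy μ ≤ E := by
  intro h
  obtain ⟨hs, hd, hm, hn⟩ := singleMode_admissible e2_ne_zero dotc_e2_zhat
  refine not_ceiling_of_singleMode e2_ne_zero dotc_e2_zhat zhat_ne_zero (h _ hs hd hm ?_)
  rw [hn, norm_zhat]
  norm_num

/-- **FMRT's a priori support bound is attained.** For the Kolmogorov force `f = Re(e_{e₂} z)`
(`e₂·z = 0`; `λ₁ = 4π²`) and every `ν > 0` some stationary statistical solution has mean energy
EXACTLY `‖f‖₂²/(16π⁴ν²) = ‖f‖₂²/(ν²λ₁²)`, the value of the a priori bound `|u| ≤ |f|/(νλ₁)`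
(FMRT IV (1.34)) that every stationary statistical solution obeys: on the statistical side no
ν-uniform energy bound can come from estimates in `‖f‖₂` and `ν` alone. -/
theorem kolmogorov_attains_support_bound (z : (EuclideanSpace ℂ (Fin 3)))
    (hz : ((fun j => (((![0, 1, 0] : Fin 3 → ℤ)) j : ℂ)) ⬝ᵥ (WithLp.ofLp (z))) = 0) {ν : ℝ} (hν : 0 < ν) :
    ∃ μ : Measure (Torus.energySpace (Fin 3)),
      Torus.IsStationaryStatisticalSolution ν (Torus.realTrigPoly {(![0, 1, 0] : Fin 3 → ℤ)} (fun _ => z)) μ ∧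
        Integrable (fun v : (Torus.energySpace (Fin 3)) => ‖v‖ ^ 2) μ ∧
          Torus.ensembleEnergy μ = (∫ x, ‖(Torus.realTrigPoly {(![0, 1, 0] : Fin 3 → ℤ)} (fun _ => z)) x‖ ^ 2) / (16 * Real.pi ^ 4 * ν ^ 2) := by
  obtain ⟨μ, hμ, hint, hen⟩ := exists_fat_stationary_of_singleMode e2_ne_zero hz hν
  refine ⟨μ, hμ, hint, ?_⟩
  rw [hen, integral_norm_sq_mode e2_ne_zero, freqNormSq_e2]
  field_simp
  ring

/-! ### Load-bearing hypothesis: the Liouville equation (1.30) -/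

/-- **Any proof of `EnsembleCeiling` must use the stationary Liouville equation (1.30).** For EVERY
admissible force `f`, every `E` and every `ν₀ > 0` there are `ν ∈ (0, ν₀)` and a Borel probability
measure on `H` with finite mean enstrophy (1.29), the shell energy inequalities (1.31) and
integrable energy — every clause of FMRT IV Def. 1.3 except (1.30) — whose mean energy exceeds `E`:
the Dirac mass at the ray state `T f`, `T = max(1, (|E|+1)/‖f‖₂²)`, at
`ν = min(ν₀/2, ‖f‖₂²/((‖∇f‖₂²+1)T))` (then `νT²‖∇f‖² ≤ T‖f‖²`, energy `T²‖f‖₂² > E`). -/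
theorem fat_without_liouville {f : ((UnitAddTorus (Fin 3)) → (EuclideanSpace ℝ (Fin 3)))} (hf : Torus.IsSmooth f) (hdf : Torus.IsDivFree f)
    (hzm : Torus.HasZeroMean f) (hf0 : 0 < ∫ x, ‖f x‖ ^ 2) (E : ℝ) {ν₀ : ℝ} (hν₀ : 0 < ν₀) :
    ∃ ν : ℝ, 0 < ν ∧ ν < ν₀ ∧ ∃ μ : Measure (Torus.energySpace (Fin 3)),
      IsProbabilityMeasure μ ∧
      ∫⁻ u, Torus.eGradNormSq (((u : (Torus.energySpace (Fin 3))) : (Lp (EuclideanSpace ℝ (Fin 3)) 2 (volume : Measure (UnitAddTorus (Fin 3))))) : ((UnitAddTorus (Fin 3)) → (EuclideanSpace ℝ (Fin 3)))) ∂μ < ∞ ∧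
      (∀ e₁ e₂ : ℝ≥0∞, e₁ < e₂ →
        ∫ u in {u : (Torus.energySpace (Fin 3)) | e₁ ≤ ‖u‖ₑ ^ 2 ∧ ‖u‖ₑ ^ 2 < e₂},
          (ν * (Torus.eGradNormSq (((u : (Torus.energySpace (Fin 3))) : (Lp (EuclideanSpace ℝ (Fin 3)) 2 (volume : Measure (UnitAddTorus (Fin 3))))) : ((UnitAddTorus (Fin 3)) → (EuclideanSpace ℝ (Fin 3))))).toReal - Torus.pairing ((u : (Torus.energySpace (Fin 3))) : (Lp (EuclideanSpace ℝ (Fin 3)) 2 (volume : Measure (UnitAddTorus (Fin 3))))) f) ∂μ ≤ 0) ∧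
      Integrable (fun v : (Torus.energySpace (Fin 3)) => ‖v‖ ^ 2) μ ∧
      E < Torus.ensembleEnergy μ := by
  set F2 : ℝ := ∫ x, ‖f x‖ ^ 2 with hF2
  set G : ℝ := Torus.gradNormSq f with hGdef
  have hG0 : 0 ≤ G := Torus.gradNormSq_nonneg f
  set T : ℝ := max 1 ((|E| + 1) / F2) with hT
  have hT1 : 1 ≤ T := le_max_left _ _
  have hTpos : 0 < T := lt_of_lt_of_le one_pos hT1
  have hTE : E < T ^ 2 * F2 := by
    have h1 : (|E| + 1) / F2 ≤ T := le_max_right _ _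
    have h2 : |E| + 1 ≤ T * F2 := by rwa [div_le_iff₀ hf0] at h1
    have h3 : T * F2 ≤ T ^ 2 * F2 := by nlinarith [mul_pos hTpos hf0]
    linarith [le_abs_self E]
  have hGT : 0 < (G + 1) * T := by positivity
  set ν : ℝ := min (ν₀ / 2) (F2 / ((G + 1) * T)) with hνdef
  have hνpos : 0 < ν := lt_min (half_pos hν₀) (div_pos hf0 hGT)
  have hνlt : ν < ν₀ := (min_le_left _ _).trans_lt (half_lt_self hν₀)
  have hνle : ν * ((G + 1) * T) ≤ F2 := by
    rw [← le_div_iff₀ hGT]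
    exact min_le_right _ _
  -- the ray state `T • f`
  set uf : ((UnitAddTorus (Fin 3)) → (EuclideanSpace ℝ (Fin 3))) := T • f with huf
  have hsm : Torus.IsSmooth uf := hf.smul T
  have huf' : uf = fun y => ∑ i ∈ ({0} : Finset ℕ), (fun _ : ℕ => T) i • (fun _ : ℕ => f) i y := by
    funext y
    simp [huf]
  have hdfu : Torus.IsDivFree uf := by
    rw [huf']
    exact Torus.IsDivFree.sum_smul _ _ (fun _ => hf) (fun _ => hdf)
  have hzmu : Torus.HasZeroMean uf := by
    rw [huf']
    exact Torus.HasZeroMean.sum_smul _ _ (fun _ => hf.integrable) (fun _ => hzm)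
  have hmem : MemLp uf 2 volume := hsm.memLp 2
  obtain ⟨u, hu⟩ : ∃ u : (Torus.energySpace (Fin 3)), (((u : (Torus.energySpace (Fin 3))) : (Lp (EuclideanSpace ℝ (Fin 3)) 2 (volume : Measure (UnitAddTorus (Fin 3))))) : ((UnitAddTorus (Fin 3)) → (EuclideanSpace ℝ (Fin 3)))) =ᵐ[volume] uf :=
    ⟨⟨hmem.toLp uf, Torus.smoothSolenoidal_subset_energySpace ⟨uf, hsm, hdfu, hzmu, hmem.coeFn_toLp⟩⟩,
      hmem.coeFn_toLp⟩
  have hgrad : Torus.eGradNormSq (((u : (Torus.energySpace (Fin 3))) : (Lp (EuclideanSpace ℝ (Fin 3)) 2 (volume : Measure (UnitAddTorus (Fin 3))))) : ((UnitAddTorus (Fin 3)) → (EuclideanSpace ℝ (Fin 3)))) = ENNReal.ofReal (T ^ 2 * G) := by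
    rw [eGradNormSq_congr_ae' hu, Torus.eGradNormSq_eq_ofReal_gradNormSq hsm, huf, DenseLoudDesignerForces.Negative.gradNormSq_const_smul hf T]
  have hpair : Torus.pairing ((u : (Torus.energySpace (Fin 3))) : (Lp (EuclideanSpace ℝ (Fin 3)) 2 (volume : Measure (UnitAddTorus (Fin 3))))) f = T * F2 := by
    rw [pairing_of_ae hu f, huf, hF2, ← integral_const_mul]
    refine integral_congr_ae (ae_of_all _ fun x => ?_)
    simp only [Pi.smul_apply, real_inner_smul_left, real_inner_self_eq_norm_sq]
  have hnorm : ‖u‖ ^ 2 = T ^ 2 * F2 := by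
    rw [norm_sq_of_ae hu, huf, hF2, ← integral_const_mul]
    refine integral_congr_ae (ae_of_all _ fun x => ?_)
    simp only [Pi.smul_apply, norm_smul, mul_pow, Real.norm_eq_abs, sq_abs]
  haveI : MeasurableSingletonClass (Torus.energySpace (Fin 3)) := OpensMeasurableSpace.toMeasurableSingletonClass
  refine ⟨ν, hνpos, hνlt, Measure.dirac u, inferInstance, ?_, ?_, Torus.integrable_dirac u _, ?_⟩
  · rw [lintegral_dirac, hgrad]
    exact ENNReal.ofReal_lt_top
  · intro e₁ e₂ _
    classical
    rw [setIntegral_dirac]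
    split_ifs
    · rw [hgrad, hpair, ENNReal.toReal_ofReal (by positivity), sub_nonpos]
      calc ν * (T ^ 2 * G) ≤ ν * (T ^ 2 * (G + 1)) := by gcongr; linarith
        _ = T * (ν * ((G + 1) * T)) := by ring
        _ ≤ T * F2 := mul_le_mul_of_nonneg_left hνle hTpos.le
    · exact le_rfl
  · unfold Torus.ensembleEnergy
    rw [integral_dirac, hnorm]
    exact hTE

/-! ### The integrability hypothesis is decoration -/

/-- **The hypothesis `Integrable (‖·‖²) μ` of the crux is removable**: a non-integrable energy
gives the Bochner junk value `ensembleEnergy μ = 0`, so `EnsembleCeiling` implies its variant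
without the hypothesis, with `E` replaced by `max E 0` (the converse is trivial). Provers may
drop it; it is anyway automatic from FMRT's support bound (1.34). -/
theorem ensembleCeiling_integrable_redundant
    (h : Summit.AnomalousDissipation.AnomalousDissipation.Theses.TaylorCertificates.EnsembleCeiling) :
    ∃ f : ((UnitAddTorus (Fin 3)) → (EuclideanSpace ℝ (Fin 3))), Torus.IsSmooth f ∧ Torus.IsDivFree f ∧ Torus.HasZeroMean f ∧ 0 < (∫ x, ‖f x‖ ^ 2) ∧
      ∃ (E ν₀ : ℝ), 0 < ν₀ ∧ ∀ ν : ℝ, 0 < ν → ν < ν₀ → ∀ μ : Measure (Torus.energySpace (Fin 3)),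
        Torus.IsStationaryStatisticalSolution ν f μ → Torus.ensembleEnergy μ ≤ E := by
  obtain ⟨f, hs, hd, hm, hp, E, ν₀, hν₀, h⟩ := h
  refine ⟨f, hs, hd, hm, hp, max E 0, ν₀, hν₀, fun ν hν hνlt μ hμ => ?_⟩
  by_cases hint : Integrable (fun v : (Torus.energySpace (Fin 3)) => ‖v‖ ^ 2) μ
  · exact (h ν hν hνlt μ hμ hint).trans (le_max_left _ _)
  · unfold Torus.ensembleEnergy
    rw [integral_undef hint]
    exact le_max_right _ _

end Summit.AnomalousDissipation.AnomalousDissipation.Theorems.EnsembleCeiling.Negative
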